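import Literature.MathematicalPhysics.QuantumLattice.KomaPiFluxLatticeConstantBound
import HarnessLib

/-!
# Koma's lattice constant as an integral: `I_D² = D⁻¹(2π)^{-D}∫{Σᵢcos pᵢ}₊²/E_p dp`, the limit of the
# finite-volume sums, and the certified bound `I_D² ≤ D·R(D) - 1 - 1/(8D) ≤ 0.4864` for every `D ≥ 3`

T. Koma, *Nambu–Goldstone modes for superconducting lattice fermions*, arXiv:2201.13135 (2022)
[Koma2022], (6.24) and (6.37)–(6.38): the constant `I_d` of Theorem 2.1,
`(I_d)² = ∫dp {-d⁻¹Σ_m cos p^{(m)}}₊² / (1 + d⁻¹Σ_m cos p^{(m)})` ((6.37), normalised momentum integral),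
i.e. — after the shift `p ↦ p + Q`, `Q = (π,…,π)`, under which `Σcos ↦ -Σcos` — `d⁻¹(2π)^{-d}∫{Σcos}₊²/E`
with `E_p = Σ_m(1 - cos p^{(m)})`; "Our numerical computations show `I_3 = 0.68⋯` and `I_4 = 0.44⋯`"
(after (6.36)).

* `latticeConstantIntegrand`, `latticeConstantSq D` — the integrand `{Σᵢcos pᵢ}₊²/E_p` and Koma's `(I_D)²`
  in the shifted form (Lebesgue integral over the Brillouin zone `[-π,π]^D`);
* `idSq_approx` — **sums to integrals**: the finite-volume lattice sums `I²_{D,Λ} = idSq d L` of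
  `KomaPiFluxLongRangeOrderBound` converge to `latticeConstantSq D` along the even sides (`D = d + 1 ≥ 3`;
  the tree's punctured-Riemann-sum theorem for symbols with an integrable `1/E` singularity,
  `PuncturedRiemannSum.momentumAverage_singular_approx`, majorant `{Σcos}₊²/E ≤ D²/E`);
* **`latticeConstantSq_le`**, **`latticeConstantSq_le_const`**, `latticeConstantSq_lt_half` — passing to the
  limit in `idSq_le_torusGreen`: `I_D² ≤ D·R(D) - 1 - 1/(8D) ≤ 0.4864 < 1/2` for every `D ≥ 3`
  (`R(D) = latticeGreen 0`; `dim_mul_latticeGreen_sub_le`). For `D = 3` this is a PROVED enclosure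
  `I_3² ≤ 0.4864` of the printed numerical value `I_3² = 0.462…`; for `D ≥ 4`, `I_D² ≤ 0.2413`
  (`latticeConstantSq_le_of_four_le`; printed `I_4² = 0.194…`).

No named fact. (The identification of the shifted form with the literal (6.37) is the substitution
`p ↦ p + Q` on the torus, as in `idSq`'s docstring; not repeated here.)

## References

* [Koma2022] T. Koma, arXiv:2201.13135, (6.24), (6.37)–(6.39), after (6.36).
* [KLS1988PRL] T. Kennedy, E. H. Lieb, B. S. Shastry, Phys. Rev. Lett. 61 (1988) 2582, before eq. (2)
  ("passing from sums to integrals").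
* [SalmhoferSeiler1991] M. Salmhofer, E. Seiler, Commun. Math. Phys. 139 (1991) 395, Prop. A.6, p. 430.
-/

noncomputable section

namespace Literature.MathematicalPhysics.QuantumLattice

open MeasureTheory Finset Filter Topology
open Literature.Probability.LatticeModels
  Literature.MathematicalPhysics.QuantumFieldTheory.Balaban1983to89.Beta

namespace KomaPiFlux

variable {D : ℕ}

/-! ### The integrand and the constant -/

/-- The integrand `{Σᵢ cos pᵢ}₊² / E_p` of Koma's `(I_d)²` ((6.24); junk `0` where `E_p = 0`).
[cite: Koma2022, (6.24)] -/
def latticeConstantIntegrand (p : Fin D → ℝ) : ℝ :=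
  max (∑ i, Real.cos (p i)) 0 ^ 2 / dispersion p

variable (D) in
/-- **Koma's lattice constant** `(I_D)² = D⁻¹(2π)^{-D}∫_{[-π,π]^D} {Σᵢcos pᵢ}₊²/E_p dp` ((6.24) in infinite
volume; (6.37) after `p ↦ p + Q`). [cite: Koma2022, (6.24), (6.37)] -/
def latticeConstantSq : ℝ :=
  (∫ p in brillouin D, latticeConstantIntegrand p) / ((2 * Real.pi) ^ D * D)

/-- The integrand is nonnegative. [cite: Koma2022, (6.24)] -/
theorem latticeConstantIntegrand_nonneg (p : Fin D → ℝ) : 0 ≤ latticeConstantIntegrand p :=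
  div_nonneg (sq_nonneg _) (dispersion_nonneg _)

/-- `(I_D)² ≥ 0`. [cite: Koma2022, (6.24)] -/
theorem latticeConstantSq_nonneg (D : ℕ) : 0 ≤ latticeConstantSq D :=
  div_nonneg (setIntegral_nonneg (measurableSet_brillouin D) fun p _ => latticeConstantIntegrand_nonneg p)
    (by positivity)

/-- The integrand is `2π`-periodic in every coordinate. [cite: Koma2022, (6.24)] -/
theorem latticeConstantIntegrand_add_two_pi_mul_int (p : Fin D → ℝ) (q : Fin D → ℤ) :
    latticeConstantIntegrand (fun i => p i + 2 * Real.pi * (q i : ℝ)) = latticeConstantIntegrand p := by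
  have hc : ∀ i, Real.cos (p i + 2 * Real.pi * (q i : ℝ)) = Real.cos (p i) := fun i => by
    rw [show p i + 2 * Real.pi * (q i : ℝ) = p i + (q i : ℝ) * (2 * Real.pi) by ring,
      Real.cos_add_int_mul_two_pi]
  simp only [latticeConstantIntegrand, dispersion, hc]

/-- The integrand is continuous wherever `E_p > 0`. [cite: Koma2022, (6.24)] -/
theorem continuousAt_latticeConstantIntegrand {p : Fin D → ℝ} (hp : 0 < dispersion p) :
    ContinuousAt (latticeConstantIntegrand (D := D)) p := by
  have hC : Continuous fun q : Fin D → ℝ => ∑ i, Real.cos (q i) := by fun_prop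
  exact ((hC.max continuous_const).pow 2).continuousAt.div (continuous_dispersion _).continuousAt hp.ne'

/-- **The `1/E` majorant**: `{Σcos}₊²/E_p ≤ D²/E_p`. [cite: Koma2022, (6.24)] -/
theorem norm_latticeConstantIntegrand_le (p : Fin D → ℝ) :
    ‖latticeConstantIntegrand p‖ ≤ 0 + (D : ℝ) ^ 2 / dispersion p := by
  rw [Real.norm_of_nonneg (latticeConstantIntegrand_nonneg p), zero_add]
  refine div_le_div_of_nonneg_right ?_ (dispersion_nonneg p)
  have hC : ∑ i, Real.cos (p i) ≤ D := by
    have h := sum_le_sum (s := (univ : Finset (Fin D))) fun i _ => Real.cos_le_one (p i)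
    simp only [sum_const, card_univ, Fintype.card_fin, nsmul_eq_mul, mul_one] at h
    exact h
  have h0 : 0 ≤ max (∑ i, Real.cos (p i)) 0 := le_max_right _ _
  have h1 : max (∑ i, Real.cos (p i)) 0 ≤ D := max_le hC (Nat.cast_nonneg D)
  exact pow_le_pow_left₀ h0 h1 2

/-- On the dual torus the integrand is the summand of `idSq`. [cite: Koma2022, (6.24)] -/
theorem latticeConstantIntegrand_latticeMomentum (L : ℕ) (q : TorusSite D L) :
    latticeConstantIntegrand (latticeMomentum L q) = max (torusCosSum L q) 0 ^ 2 / dispersion (latticeMomentum L q) :=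
  rfl

/-! ### Sums to integrals -/

variable {d : ℕ}

/-- **`I²_{D,Λ} → (I_D)²` along the even sides** (`D = d + 1 ≥ 3`): for every `ε > 0` there is `L₀` with
`|idSq d L - latticeConstantSq (d+1)| ≤ ε` for all even `L ≥ L₀`. [cite: Koma2022, after (6.36) ("in the
infinite-volume limit")] [cite: KLS1988PRL, before eq. (2)] -/
theorem idSq_approx (hd : 2 ≤ d) {ε : ℝ} (hε : 0 < ε) :
    ∃ L₀ : ℕ, ∀ (L : ℕ) [NeZero L], Even L → L₀ ≤ L → |idSq d L - latticeConstantSq (d + 1)| ≤ ε := by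
  have hD : (0 : ℝ) < (d + 1 : ℝ) := by positivity
  have hG : ContinuousOn (latticeConstantIntegrand (D := d + 1)) (brillouin (d + 1) \ {0}) := fun p hp =>
    (continuousAt_latticeConstantIntegrand
      (dispersion_pos_of_mem_brillouin hp.1 fun h => hp.2 h)).continuousWithinAt
  obtain ⟨L₀, hL₀⟩ := PuncturedRiemannSum.momentumAverage_singular_approx (d := d + 1) (by omega)
    (G := latticeConstantIntegrand (D := d + 1)) (C₀ := 0) (C₁ := ((d + 1 : ℕ) : ℝ) ^ 2) le_rfl (by positivity) hG
    (fun p _ _ => norm_latticeConstantIntegrand_le p) latticeConstantIntegrand_add_two_pi_mul_int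
    (ε := (d + 1) * ε) (by positivity)
  refine ⟨L₀, fun L _ hev hL => ?_⟩
  have h := hL₀ L hev hL
  rw [smul_eq_mul, smul_eq_mul, Real.norm_eq_abs] at h
  have hLd : ((L ^ (d + 1) : ℕ) : ℝ) = (L : ℝ) ^ (d + 1) := by push_cast; ring
  rw [hLd] at h
  have hI : idSq d L = ((L : ℝ) ^ (d + 1))⁻¹ *
      (∑ k ∈ (univ : Finset (TorusSite (d + 1) L)).erase 0, latticeConstantIntegrand (latticeMomentum L k)) /
        (d + 1) := by
    unfold idSq
    simp only [latticeConstantIntegrand_latticeMomentum]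
    rw [inv_mul_eq_div, div_div, mul_comm]
  have hJ : latticeConstantSq (d + 1) =
      ((2 * Real.pi) ^ (d + 1))⁻¹ * (∫ p in brillouin (d + 1), latticeConstantIntegrand p) / (d + 1) := by
    unfold latticeConstantSq
    rw [inv_mul_eq_div, div_div]
    push_cast
    ring
  rw [hI, hJ, ← sub_div, abs_div, abs_of_pos hD, div_le_iff₀ hD]
  linarith

/-! ### The certified bound in every dimension -/

/-- **`(I_D)² ≤ D·R(D) - 1 - 1/(8D)` for `D ≥ 3`** (`R(D) = latticeGreen 0`): the limit of the finite-volume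
inequality `idSq_le_torusGreen`. [cite: Koma2022, (6.24), after (6.36)] -/
theorem latticeConstantSq_le (hD : 3 ≤ D) :
    latticeConstantSq D ≤ D * latticeGreen (0 : Site D) - 1 - 1 / (8 * D) := by
  obtain ⟨d, rfl⟩ : ∃ d, D = d + 1 := ⟨D - 1, by omega⟩
  have hd : 2 ≤ d := by omega
  by_contra hlt
  push Not at hlt
  set B : ℝ := ((d + 1 : ℕ) : ℝ) * latticeGreen (0 : Site (d + 1)) - 1 - 1 / (8 * ((d + 1 : ℕ) : ℝ)) with hB
  set ε : ℝ := (latticeConstantSq (d + 1) - B) / 3 with hε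
  have hε0 : 0 < ε := by rw [hε]; linarith
  obtain ⟨k₀, hk₀⟩ := idSq_eventually_le (d := d) hd hε0
  obtain ⟨L₀, hL₀⟩ := idSq_approx (d := d) hd hε0
  set k : ℕ := max k₀ (L₀ + 1) with hk
  haveI : NeZero (2 * k) := ⟨by omega⟩
  have h1 := hk₀ k (le_max_left _ _)
  have h2 := hL₀ (2 * k) (even_two_mul k) (by omega)
  rw [abs_le] at h2
  have hB' : (d + 1 : ℝ) * latticeGreen (0 : Site (d + 1)) - 1 - 1 / (8 * (d + 1)) = B := by
    rw [hB]; push_cast; ring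
  rw [hB'] at h1
  linarith [h2.1]

/-- **`(I_D)² ≤ 0.4864 < 1/2` for every `D ≥ 3`** — a proved enclosure of Koma's numerical constants
(`I_3² = 0.462…`, `I_4² = 0.194…`). [cite: Koma2022, after (6.36)] [cite: SalmhoferSeiler1991, Prop. A.6] -/
theorem latticeConstantSq_le_const (hD : 3 ≤ D) : latticeConstantSq D ≤ 4864 / 10000 :=
  (latticeConstantSq_le hD).trans (dim_mul_latticeGreen_sub_le hD)

/-- `(I_D)² < 1/2` (`D ≥ 3`): the threshold of this series' form of (6.34)–(6.35). [cite: Koma2022, Theorem 2.1] -/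
theorem latticeConstantSq_lt_half (hD : 3 ≤ D) : latticeConstantSq D < 1 / 2 := by
  linarith [latticeConstantSq_le_const hD]

/-- In `D ≥ 4` directions the bound is `(I_D)² ≤ 4R(4) - 1 - 1/(8D) ≤ 0.2413`.
[cite: Koma2022, (6.37)–(6.39)] [cite: SalmhoferSeiler1991, Prop. A.6, p. 430] -/
theorem latticeConstantSq_le_of_four_le (hD : 4 ≤ D) : latticeConstantSq D ≤ 2413 / 10000 := by
  refine (latticeConstantSq_le (by omega)).trans ?_
  have hmono := dim_mul_latticeGreen_zero_le_of_le (d := 4) (d' := D) (by norm_num) hD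
  have h4 := four_mul_latticeGreen_four_zero_le
  have hD0 : (0 : ℝ) < D := by exact_mod_cast (show 0 < D by omega)
  have hpos : (0 : ℝ) < 1 / (8 * D) := by positivity
  push_cast at hmono
  linarith

end KomaPiFlux

end Literature.MathematicalPhysics.QuantumLattice

end
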